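import Summits.BirchSwinnertonDyer.Rank1Residual.Additive.GordChiBranchKatoComponent
import Summits.BirchSwinnertonDyer.Rank1Residual.Additive.GordRatMainConjLowerBoundThree
import Summits.BirchSwinnertonDyer.Rank1Residual.Additive.TypeGThreeTowerOfSurj
import Summits.BirchSwinnertonDyer.Rank1Residual.Additive.TypeGIntegralJ
import Summits.BirchSwinnertonDyer.Rank1Residual.GaloisImage.JWitnessTowerSurjectivity
import Literature.NumberTheory.EllipticCurves.Kato2004.BigImageDivisibilityCyclotomicPrimeComponentOfHalf
import Literature.NumberTheory.EllipticCurves.PAdicBSDSkinnerUrbanProofs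
import Literature.NumberTheory.EllipticCurves.CyclotomicIwasawaMainTheoremIrreducibleBaseChangeProofs
import HarnessLib

/-!
# The located gap of T-N10R in its NATIVE shape: the RATIONAL one-sided Skinner–Urban containment
# `char_Λ X ⊆ (L_p⁻(f♭, α, ω^{(p−1)/2}))` in `Λ ⊗ ℚ_p` on the ODD branch — typed; and the kernel
# theorem that Kato's printed half upgrades it to the rational branch main conjecture
# `ChiBranchRatCharEqOddAt` (cell `b2b-bsdres`, team n1011, seat n1011-p06 gen 2, OWNERS row T-N10R, phase 4)

HONEST FRAMING (cell `b2b-bsdres`, run/shared/lean/b2b/bsd-rank1-residual/, verbatim in every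
file): the goal of the cell is to DELETE the COMBINATION-SHAPED residual classes of the
Birch–Swinnerton-Dyer formula for ALL analytic-rank `≤ 1` elliptic curves over `ℚ` — "full BSD
formula for every rank `≤ 1` curve in class `C`" assembled STRICTLY from published theorems — so
that the rank-`≤ 1` remainder becomes exactly the CONSTRUCTION-SHAPED classes, which are TYPED
(missing-input `Prop`s), NOT attempted. This is not "finishing BSD". Team n1011 (X4 ∧ `p = 3` / the
additive block, §I items N10 / N11): research routes; prove what is provable now; no claim beyond
the stated classes; X4♯(G-ord) / X3♯(G-ord) stay CONSTRUCTION-SHAPED; labels / census / located gap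
UNCHANGED; nothing is booked. ONE definition (a typed input, nothing asserted) and theorems; no new
named fact (the Literature inputs are the explicit binders `hKW` = Wuthrich 2014 / Kato 17.4 (3)
half-eigenspace reading, `hDel3`, `hDel`).

## What and why

Row T-N10R's typed input so far (`GordRatMainConjLowerBoundOdd.lean`, p249862) is the rational
EQUALITY `ChiBranchRatCharEqOddAt W p`: `char_Λ X(E/ℚ_∞) = (g)`, `ι g = p^k · ϖ⁻ · L_p⁻(f♭, α, ω^{(p−1)/2}, T)`.
An equality is two containments. ONE of them is IN PRINT: Kato 2004 Thm. 17.4 (3) read on the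
`ω^{(p−1)/2}`-component of `Sel_{p^∞}(E♭/ℚ(μ_{p^∞}))` (the tree's reading fact, in the general
half-eigenspace form `Wuthrich2014.kato_halfEigenCharIdeal_dvd_cyclotomicPrime_of_surjective` of
referee ruling R118.3, specialised by `Kato2004.charIdeal_dvd_padicLFunctionBranch_component_of_surjective_of_half`),
transported to `X(E/ℚ_∞)` of the ADDITIVE curve by additive-p1/p2's eigen-descent
(`SelmerDualData.exists_chiEigenInCyclotomic`, used verbatim as in additive-p2's Brick 5′
`chiBranchLeadingTermOddBigImageAt_of_katoComponent`, which exported only the `T = 0` shadow). The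
OTHER containment — `char_Λ X ⊆ (ϖ⁻ L_p⁻)` in `Λ ⊗ ℚ_p`, the Skinner–Urban direction — is the located
gap, and `Λ ⊗ ℚ_p` is the NATIVE currency of every Skinner–Urban-type theorem (SU 2014 Cor. 3.6.2 /
Thm. 3.6.4 first display: "`Ch^Σ_{ℚ_∞,L}(f) = (L^Σ_f)` in `Λ_{ℚ,O_L} ⊗_{ℤ_p} ℚ_p`"). So:

* §0 TYPED: `ChiBranchRatLowerDvdOddAt W p` — for every good-ordinary twist model `V = E♭`
  (`C • V^{(−p)} = W`), newform `f`, cyclotomic `κ/γ`, `Λ`-dual datum `D` of `Sel_{p^∞}(W/ℚ_∞)` and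
  `ϖ⁻·|Ω⁻(V)| = Ω⁻_f`: every `g ∈ char_Λ X` satisfies `p^m g ∈ (G)` for some `G ∈ Λ` with
  `ι G = p^n · ϖ⁻ · L_p⁻(f, α, ω^{(p−1)/2}, T)` — i.e. `char_Λ X ⊆ (ϖ⁻ L_p⁻)·(Λ ⊗ ℚ_p)`. Nothing asserted.
  WEAKER than each of the three typed inputs already in the tree on this locus (this seat's rational
  equality; n1011-p07's integral containment `ChiBranchLowerDivisibilityOddAt`; n1011-p10's
  `QuadraticBranchLowerDivisibilityAt`), and exactly the shape a proof along SU 2014 §3.6 for the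
  Eisenstein datum with `ξ = ω^{(p−1)/2} ∘ Nm` would print (n1011-p17 / lit-su L2: Prop. 13.4.1 is
  printed for `ξ = 1` only — the gap).
* §1 KERNEL (Kato's half on `X(E/ℚ_∞)`, full series): `hKW` + `0 ≤ ord_p j(E)` + tower surjectivity
  of the twist ⟹ `X(W/ℚ_∞)` torsion and some `g₁ ∈ char_Λ X` has `ι g₁ = u · ϖ⁻ · L_p⁻(…)`, `u ∈ ℤ_pˣ`.
* §2 KERNEL (the split): §1 + §0 ⟹ `ChiBranchRatCharEqOddAt W p` (tree bookkeeping
  `exists_span_eq_and_map_eq_C_zpow_mul` = the proof of SU Thm. 3.6.4 p. 43: two divisibilities in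
  `Λ ⊗ ℚ_p` give equality of principal ideals up to `p^k`), given the tower of `W` (transported to `V`
  by `GaloisImage.hasSurjectiveModNGaloisRep_pow_iff_of_model_twist`).
* §3 ENDS at `p = 3` on X4♯(G-ord)@3 ∧ surj(3) (tower from surj(3) ALONE, n1011-p14
  `TypeG.towerSurj_three_of_surj`; `0 ≤ ord₃ j` from `TypeGOrd`): `ChiBranchRatLowerDvdOddAt W 3` +
  ONE unit coefficient ⟹ `ChiBranchRatCharEqOddAt W 3` ⟹ (p252109) the LOWER half off the anomalous
  rows and `BSD(E,3)`; so on the Gord3 rows of N11 the typed input is the ONE-SIDED rational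
  containment and NOTHING ELSE typed.

X4♯(G-ord) stays CONSTRUCTION-SHAPED; located gap unchanged in substance, now stated in the currency
of the theorem that would close it; nothing booked; no label change.

References: C. Skinner, E. Urban, Invent. Math. 195 (2014) Cor. 3.6.2 (p. 42), Thm. 3.6.4 and its
proof (p. 43) [SkinnerUrban2014]; K. Kato, Astérisque 295 (2004) Thm. 17.4 (3) (p. 273), (12.5.2)
(p. 222) [Kato2004Asterisque]; C. Wuthrich, J. London Math. Soc. 90 (2014) §3 (p. 390), Lemma 20
(p. 399) [Wuthrich2014]; Mazur–Tate–Teitelbaum, Invent. Math. 84 (1986) §I.12–I.14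
[MazurTateTeitelbaum1986Invent]; R. Greenberg, LNM 1716 (1999) §5 (p. 143) [GreenbergLNM1716];
D. Delbourgo, J. Number Theory 95 (2002) Theorem (A), (B) (p. 40) [Delbourgo2002]; D. Delbourgo,
Compositio Math. 113 (1998) Prop. 4 (p. 144) [Delbourgo1998]; R. L. Miller, LMS J. Comput. Math. 14
(2011) Def. 1.1 [Miller2011LMS]; Burungale–Castella–Skinner, IMRN 2025 Thm. 1.1.2 (a) (shape only)
[BurungaleCastellaSkinner2025].
-/

noncomputable section

open scoped Classical MatrixGroups ModularForm NumberField

open CongruenceSubgroup WeierstrassCurve NumberField Literature.NumberTheory.EllipticCurves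
  Literature.NumberTheory.EllipticCurves.ModularForms
  Literature.NumberTheory.EllipticCurves.Rank1Residual
  Literature.NumberTheory.EllipticCurves.Rank1Residual.Typed
  Literature.NumberTheory.GaloisRepresentations
  IsDedekindDomain

namespace Summit.BirchSwinnertonDyer.Rank1Residual.Additive

/-! ### §0 The typed input: the one-sided RATIONAL Skinner–Urban containment on the odd branch -/

/-- **The Skinner–Urban direction of the `ω^{(p−1)/2}`-branch (ODD) cyclotomic main conjecture of the
good-ordinary twist, RATIONALLY, TYPED** (`p ≡ 3 (mod 4)`). For the additive curve `E = W` (globally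
minimal): whenever `W = C • V^{(−p)}` for a globally minimal `V = E♭` good ordinary at `p` with newform
`f`, `κ`/`γ` is the cyclotomic `ℤ_p`-extension with a generator matching the cyclotomic variable, `D`
is a `Λ`-dual datum of `Sel_{p^∞}(W/ℚ_∞)` and `ϖ · |Ω⁻(V)| = Ω⁻_f`, EVERY `g ∈ char_Λ X(W/ℚ_∞)` lies in
`(ϖ · L_p⁻(f, α, ω^{(p−1)/2}, T)) · (Λ ⊗_{ℤ_p} ℚ_p)`: `p^m · g ∈ (G)` for some `G ∈ Λ`, `m n ∈ ℕ`, with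
`ι G = p^n · ϖ · L_p⁻(f, α, ω^{(p−1)/2}, T)` (`α = unitRoot V p`, the ODD branch on the minus symbols,
MTT §I.13; `ι : Λ ↪ ℚ_p⟦T⟧`). This is the SHAPE of Skinner–Urban 2014 Cor. 3.6.2 / Thm. 3.6.4 (first
display, "in `Λ_{ℚ,O_L} ⊗_{ℤ_p} ℚ_p`") on the `χ_{−p}`-branch of the twist — printed there for the
trivial branch only. OPEN — OUR typed missing input (`@[conjecture]`, a predicate on `(W, p)`); nothing asserted.
[cite: SkinnerUrban2014, Cor. 3.6.2 (p. 42) and Thm. 3.6.4 (p. 43) (shape only; nothing asserted)]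
[cite: MazurTateTeitelbaum1986Invent, §I.12–I.13 (shape only; nothing asserted)] -/
@[conjecture] def ChiBranchRatLowerDvdOddAt (W : WeierstrassCurve ℚ) (p : ℕ) [Fact p.Prime] : Prop :=
  ∀ (V : WeierstrassCurve ℚ) [V.IsElliptic] [V.IsGloballyMinimal]
    {κ : ZpExtension ℚ p} {γ : Field.absoluteGaloisGroup ℚ} {N : ℕ} [NeZero N]
    {f : CuspForm (Gamma0 N) 2},
    p % 4 = 3 →
    (∃ C : VariableChange ℚ, C • V.quadraticTwist (-(p : ℚ)) = W) →
    GoodOrd V p →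
    κ.IsCyclotomic → κ.IsTopGenerator γ → IsCyclotomicVariable p γ → IsNewformOf V f →
    ∀ (D : W.SelmerDualData κ γ) (ϖ : ℚ), (ϖ : ℝ) * V.imaginaryPeriodRat = minusPeriod f →
      ∀ g ∈ D.charIdeal, ∃ (G : IwasawaAlgebra p) (m n : ℕ),
        PowerSeries.C ((p : ℤ_[p]) ^ m) * g ∈ Ideal.span {G} ∧
        iwasawaToPowerSeries p G =
          PowerSeries.C ((p : ℚ_[p]) ^ n) *
            (PowerSeries.C (ϖ : ℚ_[p]) * padicLFunctionMinusBranch f (unitRoot V p : ℚ_[p]) (p / 2))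

/-- Unfolding lemma for `ChiBranchRatLowerDvdOddAt` (to apply the predicate as a function). -/
theorem chiBranchRatLowerDvdOddAt_iff (W : WeierstrassCurve ℚ) (p : ℕ) [Fact p.Prime] :
    ChiBranchRatLowerDvdOddAt W p ↔
      ∀ (V : WeierstrassCurve ℚ) [V.IsElliptic] [V.IsGloballyMinimal]
        {κ : ZpExtension ℚ p} {γ : Field.absoluteGaloisGroup ℚ} {N : ℕ} [NeZero N]
        {f : CuspForm (Gamma0 N) 2},
        p % 4 = 3 →
        (∃ C : VariableChange ℚ, C • V.quadraticTwist (-(p : ℚ)) = W) →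
        GoodOrd V p →
        κ.IsCyclotomic → κ.IsTopGenerator γ → IsCyclotomicVariable p γ → IsNewformOf V f →
        ∀ (D : W.SelmerDualData κ γ) (ϖ : ℚ), (ϖ : ℝ) * V.imaginaryPeriodRat = minusPeriod f →
          ∀ g ∈ D.charIdeal, ∃ (G : IwasawaAlgebra p) (m n : ℕ),
            PowerSeries.C ((p : ℤ_[p]) ^ m) * g ∈ Ideal.span {G} ∧
            iwasawaToPowerSeries p G =
              PowerSeries.C ((p : ℚ_[p]) ^ n) *
                (PowerSeries.C (ϖ : ℚ_[p]) *
                  padicLFunctionMinusBranch f (unitRoot V p : ℚ_[p]) (p / 2)) :=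
  Iff.rfl

/-- **The rational EQUALITY implies the one-sided rational containment** (trivial direction:
`char = (g₀)`, `ι g₀ = p^k ϖ L⁻`; for `k ≥ 0` take `G = g₀`, `m = 0`, `n = k`; for `k < 0` take
`G = p^{−k} g₀`, `m = −k`, `n = 0`). Bookkeeping. [cite: SkinnerUrban2014, Thm. 3.6.4 (p. 43) (shape only)] -/
theorem chiBranchRatLowerDvdOddAt_of_ratCharEqOdd (W : WeierstrassCurve ℚ) (p : ℕ) [hp : Fact p.Prime]
    (h : ChiBranchRatCharEqOddAt W p) : ChiBranchRatLowerDvdOddAt W p := by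
  intro V _ _ κ γ N _ f hp3 hCW hV hκ hγ hcv hf D ϖ hϖ g hg
  obtain ⟨-, g₀, k, hchar, hι⟩ := h V hp3 hCW hV hκ hγ hcv hf D ϖ hϖ
  have hp0 : (p : ℚ_[p]) ≠ 0 := Nat.cast_ne_zero.mpr hp.out.ne_zero
  rw [hchar] at hg
  obtain ⟨s, rfl⟩ := Ideal.mem_span_singleton'.mp hg
  rcases le_or_gt 0 k with hk | hk
  · obtain ⟨n, rfl⟩ : ∃ n : ℕ, k = n := ⟨k.toNat, (Int.toNat_of_nonneg hk).symm⟩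
    refine ⟨g₀, 0, n, ?_, ?_⟩
    · rw [pow_zero, map_one, one_mul]
      exact Ideal.mem_span_singleton'.mpr ⟨s, rfl⟩
    · rw [hι, zpow_natCast, map_mul, mul_assoc]
  · obtain ⟨m, hm⟩ : ∃ m : ℕ, -k = m := ⟨(-k).toNat, (Int.toNat_of_nonneg (by omega)).symm⟩
    refine ⟨PowerSeries.C ((p : ℤ_[p]) ^ m) * g₀, m, 0, ?_, ?_⟩
    · exact Ideal.mem_span_singleton'.mpr ⟨s, by ring⟩
    · rw [map_mul, hι, iwasawaToPowerSeries_C_natCast_pow, pow_zero, map_one, one_mul, ← mul_assoc,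
        ← map_mul, ← mul_assoc, ← zpow_natCast, ← hm, ← zpow_add₀ hp0, neg_add_cancel, zpow_zero,
        one_mul]

/-! ### §1 Kato's half on `X(E/ℚ_∞)` — the full series (Brick 5′ before `T = 0`) -/

section KatoHalf

variable (W : WeierstrassCurve ℚ) [W.IsElliptic] (p : ℕ) [hp : Fact p.Prime]

/-- **Kato's half of the odd-branch main conjecture, on the additive curve's `X(E/ℚ_∞)`, as a power
series identity.** For `W/ℚ` potentially good at `p ≡ 3 (mod 4)` (`0 ≤ ord_p j(W)`), every globally
minimal `V`, good ordinary or multiplicative at `p` (the multiplicative case is vacuous), with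
`C • V^{(−p)} = W`, `ρ_{V,p^∞}` onto at every level, every cyclotomic `κ/γ` matching the cyclotomic
variable, newform `f` of `V`, `Λ`-dual datum `D` of `Sel_{p^∞}(W/ℚ_∞)` and `ϖ·|Ω⁻(V)| = Ω⁻_f`:
`X(W/ℚ_∞)` is `Λ`-torsion and some `g ∈ char_Λ X(W/ℚ_∞)` has `ι g = u · ϖ · L_p⁻(f, α, ω^{(p−1)/2}, T)`,
`u ∈ ℤ_pˣ`. This is additive-p2's `chiBranchLeadingTermOddBigImageAt_of_katoComponent` (gen 12) stopped
BEFORE taking the constant term: additive-p1's [C] + additive-p2's eigen-descent with generator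
normalisation (`SelmerDualData.exists_chiEigenInCyclotomic`) + the reading fact over `ℚ(μ_{p^∞})`
(Kato 2004 Thm. 17.4 (3), component `(p−1)/2`, via the half-eigenspace form `hKW` and
`…_component_of_surjective_of_half`). [cite: Kato2004Asterisque, Thm. 17.4 (3) (p. 273), (12.5.2) (p. 222)]
[cite: Wuthrich2014, §3 (p. 390)] [cite: GreenbergLNM1716, §5 p. 143] [cite: MazurTateTeitelbaum1986Invent, §I.13] -/
theorem exists_mem_charIdeal_map_eq_unit_mul_minusBranch_of_katoHalf
    (hKW : Wuthrich2014.kato_halfEigenCharIdeal_dvd_cyclotomicPrime_of_surjective)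
    (hj : 0 ≤ padicValRat p W.j)
    (V : WeierstrassCurve ℚ) [V.IsElliptic] [V.IsGloballyMinimal]
    {κ : ZpExtension ℚ p} {γ : Field.absoluteGaloisGroup ℚ} {N : ℕ} [NeZero N]
    {f : CuspForm (Gamma0 N) 2} (hp3 : p % 4 = 3)
    (hCW : ∃ C : VariableChange ℚ, C • V.quadraticTwist (-(p : ℚ)) = W) (hred : GoodOrd V p ∨ Mult V p)
    (hsurj : ∀ n : ℕ, V.HasSurjectiveModNGaloisRep (p ^ n : ℕ))
    (hκ : κ.IsCyclotomic) (hγ : κ.IsTopGenerator γ) (hcv : IsCyclotomicVariable p γ)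
    (hf : IsNewformOf V f) (D : W.SelmerDualData κ γ) (ϖ : ℚ)
    (hϖ : (ϖ : ℝ) * V.imaginaryPeriodRat = minusPeriod f) :
    D.IsTorsion ∧ ∃ g ∈ D.charIdeal, ∃ u : ℤ_[p]ˣ,
      iwasawaToPowerSeries p g =
        PowerSeries.C (((u : ℤ_[p]) : ℚ_[p]) * (ϖ : ℚ_[p])) *
          padicLFunctionMinusBranch f (unitRoot V p : ℚ_[p]) (p / 2) := by
  have hK := Kato2004.charIdeal_dvd_padicLFunctionBranch_component_of_surjective_of_half hKW
  have hp2 : p ≠ 2 := by rintro rfl; norm_num at hp3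
  have hpne : (-(p : ℚ)) ≠ 0 := neg_ne_zero.mpr (Nat.cast_ne_zero.mpr hp.out.ne_zero)
  have hodd : ¬ Even (p / 2) := by rw [Nat.not_even_iff_odd]; exact ⟨p / 4, by omega⟩
  -- `V` is good ordinary
  have hord : IsOrdinaryAt V p := isOrdinaryAt_of_goodOrd_or_mult_of_model_twist W V hpne hCW hj hred
  obtain ⟨C, hC⟩ := hCW
  -- the fields `F = ℚ(ζ_p) ⊇ K = ℚ(√−p)`
  haveI hcycL : IsCyclotomicExtension {p} ℚ (CyclotomicField p ℚ) := by
    have h : (CyclotomicField.algebra p ℚ : Algebra ℚ (CyclotomicField p ℚ)) =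
        DivisionRing.toRatAlgebra := Subsingleton.elim _ _
    exact h ▸ CyclotomicField.isCyclotomicExtension p ℚ
  obtain ⟨K, θ, hK2, hθ, hθ2⟩ := exists_intermediateField_sq_eq_pStar p (CyclotomicField p ℚ) hp2
  haveI : NumberField K := NumberField.of_module_finite ℚ K
  have hcK : θ ^ 2 = algebraMap ℚ K (-(p : ℚ)) := by
    rw [hθ2, pStar_eq_neg_of_mod_four_eq_three hp3]
  haveI : IsGalois ℚ K := isGalois_of_finrank_eq_two K hK2
  haveI := normal_galRange K hK2 (sigmaQ_ne_one K hK2 hθ hcK)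
  haveI := normal_galRange_cyclotomic p (CyclotomicField p ℚ)
  haveI : (V.quadraticTwist (-(p : ℚ))).IsElliptic := V.isElliptic_quadraticTwist hpne
  -- the `Λ`-dual datum of `e_{(p−1)/2} Sel(V/ℚ(μ_{p^∞}))` at a normalised generator, same `char`
  obtain ⟨γ', hγ'KF, hκγ', ⟨g₀, hg₀, hγ'eq⟩, D', hchar, htor⟩ :=
    SelmerDualData.exists_chiEigenInCyclotomic p (CyclotomicField p ℚ) V K hK2 hθ hcK κ hC hp2 D
  -- the fact, applied to that datum
  obtain ⟨htorX, g, hgmem, u, hιg⟩ := hK p V K (CyclotomicField p ℚ) (κ := κ) (γ := γ') (f := f)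
    (chiEigenSelmerIn V K p κ (galRange (K := ℚ) (CyclotomicField p ℚ)))
    (fun t ht ↦ conjH1_mem_chiEigenSelmerIn γ' ht) D'.X D'.toDual hp2 hK2 ⟨θ, hθ2⟩ hord hsurj hκ
    (isTopGenerator_of_kappa_eq κ hκγ' hγ)
    (isCyclotomicVariable_of_eq_mul p κ hκ hg₀ hγ'eq hcv)
    (Subgroup.mem_inf.mp hγ'KF).1 (Subgroup.mem_inf.mp hγ'KF).2 hf
    (mem_chiEigenSelmerIn_iff_ite V K κ _) D'.bijective D'.toDual_T_smul D'.toDual_C_smul ϖ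
    (by rw [if_neg hodd]; exact hϖ)
  refine ⟨htor.mp htorX, g, hchar ▸ hgmem, u, ?_⟩
  rw [hιg, if_neg hodd]

end KatoHalf

/-! ### §2 The split: Kato's half + the typed one-sided containment = the rational branch MC -/

section Split

variable {W : WeierstrassCurve ℚ} [W.IsElliptic] {p : ℕ} [hp : Fact p.Prime]

/-- **Kato's printed half + the typed RATIONAL Skinner–Urban containment ⟹ the rational odd-branch
main conjecture `ChiBranchRatCharEqOddAt W p`.** For `W/ℚ` with `0 ≤ ord_p j(W)` (e.g. the (G)-cell)
and `ρ̄_{W,p^n}` onto for all `n` (transported to the twist `V` by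
`GaloisImage.hasSurjectiveModNGaloisRep_pow_iff_of_model_twist`): from §1, `g₁ ∈ char_Λ X` with
`ι(u⁻¹ g₁) = ϖ L⁻`; from §0 at a generator `g` of `char_Λ X` (principal: `exists_charIdeal_eq_span_singleton`),
`p^m g ∈ (G)`, `ι G = p^n ϖ L⁻`; the two divisibilities in `Λ ⊗ ℚ_p` give `char_Λ X = (g')` with
`ι g' = p^k ϖ L⁻`, `k ∈ ℤ` (`exists_span_eq_and_map_eq_C_zpow_mul` — the bookkeeping of SU 2014
Thm. 3.6.4, p. 43). [cite: SkinnerUrban2014, Thm. 3.6.4, proof (p. 43)]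
[cite: Kato2004Asterisque, Thm. 17.4 (3) (p. 273)] -/
theorem chiBranchRatCharEqOddAt_of_katoHalf_of_ratLowerDvd
    (hKW : Wuthrich2014.kato_halfEigenCharIdeal_dvd_cyclotomicPrime_of_surjective)
    (hj : 0 ≤ padicValRat p W.j) (htower : ∀ n : ℕ, W.HasSurjectiveModNGaloisRep (p ^ n : ℕ))
    (hE : ChiBranchRatLowerDvdOddAt W p) : ChiBranchRatCharEqOddAt W p := by
  intro V _ _ κ γ N _ f hp3 hCW hV hκ hγ hcv hf D ϖ hϖ
  have hpne : (-(p : ℚ)) ≠ 0 := neg_ne_zero.mpr (Nat.cast_ne_zero.mpr hp.out.ne_zero)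
  -- the tower of `V` from that of `W`
  have hsurjV : ∀ n : ℕ, V.HasSurjectiveModNGaloisRep (p ^ n : ℕ) := fun n ↦
    (GaloisImage.hasSurjectiveModNGaloisRep_pow_iff_of_model_twist V p hpne hCW n).mp (htower n)
  -- Kato's half (§1)
  obtain ⟨htor, g₁, hg₁, u, hιg₁⟩ :=
    exists_mem_charIdeal_map_eq_unit_mul_minusBranch_of_katoHalf W p hKW hj V hp3 hCW (Or.inl hV)
      hsurjV hκ hγ hcv hf D ϖ hϖ
  -- a generator of `char`, and the typed containment at it
  obtain ⟨g, hchar, -⟩ := exists_charIdeal_eq_span_singleton p D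
  obtain ⟨G, m, n, hG, hιG⟩ := hE V hp3 hCW hV hκ hγ hcv hf D ϖ hϖ g
    (by rw [hchar]; exact Ideal.mem_span_singleton_self g)
  -- normalise Kato's element: `u⁻¹ g₁ ∈ (g)` with `ι (u⁻¹ g₁) = p^0 · ϖ L⁻`
  have hg₁' : PowerSeries.C ((u⁻¹ : ℤ_[p]ˣ) : ℤ_[p]) * g₁ ∈ Ideal.span {g} := by
    rw [← hchar]; exact Ideal.mul_mem_left _ _ hg₁
  have hCu : iwasawaToPowerSeries p (PowerSeries.C ((u⁻¹ : ℤ_[p]ˣ) : ℤ_[p])) =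
      PowerSeries.C ((((u⁻¹ : ℤ_[p]ˣ) : ℤ_[p]) : ℚ_[p])) := by
    rw [PowerSeries.map_C, PadicInt.algebraMap_apply]
  have hu0 : (((u : ℤ_[p]) : ℚ_[p])) ≠ 0 := by
    intro h0
    have h1 : (((u⁻¹ : ℤ_[p]ˣ) : ℤ_[p]) : ℚ_[p]) * (((u : ℤ_[p]) : ℚ_[p])) = 1 := by
      rw [← PadicInt.coe_mul, Units.inv_mul, PadicInt.coe_one]
    rw [h0, mul_zero] at h1
    exact zero_ne_one h1
  have hιg₁' : iwasawaToPowerSeries p (PowerSeries.C ((u⁻¹ : ℤ_[p]ˣ) : ℤ_[p]) * g₁) =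
      PowerSeries.C ((p : ℚ_[p]) ^ (0 : ℕ)) *
        (PowerSeries.C (ϖ : ℚ_[p]) * padicLFunctionMinusBranch f (unitRoot V p : ℚ_[p]) (p / 2)) := by
    rw [pow_zero, map_one, one_mul, map_mul, hιg₁, hCu, ← mul_assoc, ← map_mul, coe_units_inv_eq_inv,
      ← mul_assoc, inv_mul_cancel₀ hu0, one_mul]
  -- two divisibilities in `Λ ⊗ ℚ_p` ⟹ a generator `g'` with `ι g' = p^k · ϖ L⁻`
  obtain ⟨g', k, hspan, hιg'⟩ := exists_span_eq_and_map_eq_C_zpow_mul p hg₁' hιg₁' hG hιG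
  refine ⟨htor, g', k, hchar.trans hspan, ?_⟩
  rw [hιg', map_mul, mul_assoc]

end Split

/-! ### §3 The Gord3 rows: ends over `ChiBranchRatLowerDvdOddAt W 3` + ONE unit coefficient -/

section Three

variable {W : WeierstrassCurve ℚ} [W.IsElliptic] [W.IsGloballyMinimal]

/-- **X4♯(G-ord) at `3` ∧ surj(3): the rational odd-branch MC from its Skinner–Urban half** — the
tower from surj(3) alone (n1011-p14 `TypeG.towerSurj_three_of_surj`, Wuthrich Lemma 20 PROVED in the
tree), `0 ≤ ord₃ j` from `TypeGOrd` (`padicValRat_j_nonneg_of_typeGOrd`), Kato's half `hKW`.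
[cite: Kato2004Asterisque, Thm. 17.4 (3) (p. 273)] [cite: Wuthrich2014, Lemma 20 (p. 399)]
[cite: SkinnerUrban2014, Thm. 3.6.4, proof (p. 43)] -/
theorem ClassX4Gord.chiBranchRatCharEqOddAt_three_of_katoHalf_of_ratLowerDvd_of_surj
    [Fact (Nat.Prime 3)]
    (hKW : Wuthrich2014.kato_halfEigenCharIdeal_dvd_cyclotomicPrime_of_surjective)
    (hX : ClassX4Gord W 3) (hsurj : Surj W 3) (hE : ChiBranchRatLowerDvdOddAt W 3) :
    ChiBranchRatCharEqOddAt W 3 :=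
  chiBranchRatCharEqOddAt_of_katoHalf_of_ratLowerDvd hKW (padicValRat_j_nonneg_of_typeGOrd W 3 hX.typeGOrd)
    (TypeG.towerSurj_three_of_surj hX.typeGOrd.typeG hX.addv.2 hsurj) hE

/-- **X4♯(G-ord) at `3` ∧ surj(3), `r_an = 0`, non-CM, OFF the anomalous rows: the LOWER half
`ord₃ #Ш_an ≤ ord₃ #Ш` ⟸ the one-sided rational Skinner–Urban containment on the odd branch
(`ChiBranchRatLowerDvdOddAt W 3`) + ONE unit coefficient** (+ Kato's half `hKW`, Delbourgo 2002 at `3`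
`hDel3`, GZK, modularity; through §3's first theorem and p252109's
`ClassX4Gord.missingLowerBoundAt_three_rankZero_of_ratCharEqOdd_of_unitCoeff`). X4♯(G-ord) stays
CONSTRUCTION-SHAPED. [cite: SkinnerUrban2014, Cor. 3.6.2 (p. 42) (shape only)]
[cite: Kato2004Asterisque, Thm. 17.4 (3) (p. 273)] [cite: Delbourgo2002, Theorem (A), (B) (p. 40)]
[cite: Miller2011LMS, Def. 1.1] -/
theorem ClassX4Gord.missingLowerBoundAt_three_rankZero_of_ratLowerDvdOdd_of_unitCoeff_of_surj
    [Fact (Nat.Prime 3)]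
    (hKW : Wuthrich2014.kato_halfEigenCharIdeal_dvd_cyclotomicPrime_of_surjective)
    (hDel3 : Delbourgo2002.mainTheorem_three)
    (hGZK : rank_eq_analyticRank_of_analyticRank_le_one) (hmod : hasEntireLFunction_rat)
    (hmodD : nonempty_modularParametrizationData)
    (hX : ClassX4Gord W 3) (hcm : ¬ W.HasCM) (hr : W.analyticRank = 0) (hsurj : Surj W 3)
    (hna : Delbourgo2002.ReductionNonAnomalous W 3) (hE : ChiBranchRatLowerDvdOddAt W 3)
    (hcert : ∀ (V : WeierstrassCurve ℚ) [V.IsElliptic] [V.IsGloballyMinimal] (C : VariableChange ℚ),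
      GoodOrd V 3 → C • V.quadraticTwist (-(3 : ℚ)) = W →
      ∀ {N : ℕ} [NeZero N] (f : CuspForm (Gamma0 N) 2), IsNewformOf V f →
      ∀ ϖ : ℚ, (ϖ : ℝ) * V.imaginaryPeriodRat = minusPeriod f →
      ∃ n : ℕ, ‖PowerSeries.coeff n
        (PowerSeries.C (ϖ : ℚ_[3]) * padicLFunctionMinusBranch f (unitRoot V 3 : ℚ_[3]) (3 / 2))‖ = 1) :
    MissingLowerBoundAt W 3 :=
  hX.missingLowerBoundAt_three_rankZero_of_ratCharEqOdd_of_unitCoeff hDel3 hGZK hmod hmodD hcm hr hna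
    (hX.chiBranchRatCharEqOddAt_three_of_katoHalf_of_ratLowerDvd_of_surj hKW hsurj hE) hcert

/-- **The Gord3 rows of N11 — X4♯(G-ord) at `3` ∧ surj(3), `r_an = 0`, non-CM, non-anomalous:
`BSD(E,3)` ⟸ the ONE-SIDED rational Skinner–Urban containment on the odd branch of the twist
(`ChiBranchRatLowerDvdOddAt W 3`, typed — the located gap in its native `Λ ⊗ ℚ_p` currency) + ONE unit
coefficient, and NOTHING ELSE typed**: Kato's half (`hKW`, the general half-eigenspace reading;
component form by `…_of_half`) serves BOTH the upgrade to the rational equality (§2) and the UPPER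
half (additive-p2's `ω`-branch chain + n1011-p14's certificate-free tower, through n1011-p16's
`ClassX4Gord.bsdp_three_rankZero_of_cycLower_of_nonAnomalous_of_surj` inside p252109); Delbourgo 2002
at `3` (`hDel3`) and Delbourgo 1998 Prop. 4 (`hDel`) are the printed `T = 0` controls. Nothing booked;
X4♯(G-ord) stays CONSTRUCTION-SHAPED. [cite: SkinnerUrban2014, Cor. 3.6.2 (p. 42), Thm. 3.6.4 (p. 43) (shape only)]
[cite: Kato2004Asterisque, Thm. 17.4 (3) (p. 273)] [cite: Delbourgo2002, Theorem (A), (B) (p. 40)]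
[cite: Delbourgo1998, Prop. 4 (p. 144)] [cite: Miller2011LMS, §1 and Def. 1.1] -/
theorem ClassX4Gord.bsdp_three_rankZero_of_ratLowerDvdOdd_of_unitCoeff_of_surj [Fact (Nat.Prime 3)]
    (hKW : Wuthrich2014.kato_halfEigenCharIdeal_dvd_cyclotomicPrime_of_surjective)
    (hDel3 : Delbourgo2002.mainTheorem_three)
    (hDel : Delbourgo1998.prop4_rankZero_pow_dvd_constantCoeff)
    (hGZK : rank_eq_analyticRank_of_analyticRank_le_one) (hmod : hasEntireLFunction_rat)
    (hmodD : nonempty_modularParametrizationData)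
    (hX : ClassX4Gord W 3) (hcm : ¬ W.HasCM) (hr : W.analyticRank = 0) (hsurj : Surj W 3)
    (hna : Delbourgo2002.ReductionNonAnomalous W 3) (hE : ChiBranchRatLowerDvdOddAt W 3)
    (hcert : ∀ (V : WeierstrassCurve ℚ) [V.IsElliptic] [V.IsGloballyMinimal] (C : VariableChange ℚ),
      GoodOrd V 3 → C • V.quadraticTwist (-(3 : ℚ)) = W →
      ∀ {N : ℕ} [NeZero N] (f : CuspForm (Gamma0 N) 2), IsNewformOf V f →
      ∀ ϖ : ℚ, (ϖ : ℝ) * V.imaginaryPeriodRat = minusPeriod f →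
      ∃ n : ℕ, ‖PowerSeries.coeff n
        (PowerSeries.C (ϖ : ℚ_[3]) * padicLFunctionMinusBranch f (unitRoot V 3 : ℚ_[3]) (3 / 2))‖ = 1) :
    BSDp W 3 :=
  hX.bsdp_three_rankZero_of_ratCharEqOdd_of_unitCoeff_of_surj hDel3
    (Kato2004.charIdeal_dvd_padicLFunctionBranch_component_of_surjective_of_half hKW) hDel hGZK hmod
    hmodD hcm hr hsurj hna (hX.chiBranchRatCharEqOddAt_three_of_katoHalf_of_ratLowerDvd_of_surj hKW hsurj hE)
    hcert

/-- **Same rows, UNIT rows (`L(E,1) = q·Ω_E`, `ord₃ q = 0`): `BSD(E,3)` ⟸ the one-sided rational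
Skinner–Urban containment on the odd branch ALONE** (certificate free on the unit rows, census-ctyper-1
`CensusX41.unitCoeffCert_odd`; p252109 `…_of_unitLValue_of_surj`). Bookkeeping: on these rows the
LOWER half is numerically idle (`3 ∤ #E(ℚ)_tors`). Nothing booked.
[cite: SkinnerUrban2014, Cor. 3.6.2 (p. 42) (shape only)] [cite: Kato2004Asterisque, Thm. 17.4 (3) (p. 273)]
[cite: Delbourgo2002, Theorem (A), (B) (p. 40)] [cite: Delbourgo1998, Prop. 4 (p. 144)] [cite: Miller2011LMS, Def. 1.1] -/
theorem ClassX4Gord.bsdp_three_rankZero_of_ratLowerDvdOdd_of_unitLValue_of_surj [Fact (Nat.Prime 3)]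
    (hKW : Wuthrich2014.kato_halfEigenCharIdeal_dvd_cyclotomicPrime_of_surjective)
    (hDel3 : Delbourgo2002.mainTheorem_three)
    (hDel : Delbourgo1998.prop4_rankZero_pow_dvd_constantCoeff)
    (hGZK : rank_eq_analyticRank_of_analyticRank_le_one) (hmod : hasEntireLFunction_rat)
    (hmodD : nonempty_modularParametrizationData)
    (hX : ClassX4Gord W 3) (hcm : ¬ W.HasCM) (hr : W.analyticRank = 0) (hsurj : Surj W 3)
    (hna : Delbourgo2002.ReductionNonAnomalous W 3) (hE : ChiBranchRatLowerDvdOddAt W 3)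
    {q : ℚ} (hq : W.entireLFunction 1 = (q : ℂ) * (W.realPeriodRat : ℂ)) (hq0 : q ≠ 0)
    (hv : padicValRat 3 q = 0) :
    BSDp W 3 :=
  hX.bsdp_three_rankZero_of_ratCharEqOdd_of_unitLValue_of_surj hDel3
    (Kato2004.charIdeal_dvd_padicLFunctionBranch_component_of_surjective_of_half hKW) hDel hGZK hmod
    hmodD hcm hr hsurj hna (hX.chiBranchRatCharEqOddAt_three_of_katoHalf_of_ratLowerDvd_of_surj hKW hsurj hE)
    hq hq0 hv

end Three

end Summit.BirchSwinnertonDyer.Rank1Residual.Additive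

end
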